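import Literature.Analysis.FluidPDE.GKPCriticalElements
import Literature.Analysis.FunctionSpaces.LittlewoodPaleyHeatProofs
import Literature.Analysis.FunctionSpaces.LittlewoodPaleyConvergenceProofs
import Literature.Analysis.UnboundedOperators.HeatKernelStrongContinuityProofs
import Literature.Analysis.UnboundedOperators.HeatSemigroupLpProofs
import HarnessLib

/-!
# The heat semigroup is strongly continuous on `Ḃ^s_{p,q}` for `p, q < ∞`

Analysis/FluidPDE proof file (no definitions, no named facts). For `1 ≤ p < ∞`, `1 ≤ q < ∞`,
`s ∈ ℝ` and `U₀ ∈ Ḃ^s_{p,q}(E; F)` (`Literature.Analysis.FunctionSpaces.MemHomBesov`), the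
Fourier-multiplier heat flow `t ↦ e^{tΔ}U₀` (`TemperedDistribution.heatSemigroup`) is continuous
on `[0, ∞)` for the homogeneous Besov norm:
`‖e^{tΔ}U₀ - e^{t₀Δ}U₀‖_{Ḃ^s_{p,q}} → 0` as `t → t₀` within `[0, ∞)`
(`tendsto_eHomBesovNorm_heatSemigroup_sub`). This is item (F6) of the decomposition of
`exists_isBesovMildSolutionOn` (BCD Thm. 5.40 / GKP 2016, §1.2: `e^{tΔ}u₀ ∈ C([0,T]; Ḃ^{s_p}_{p,q})`).

Proof (Bahouri–Chemin–Danchin 2011, Lemma 2.4 blockwise and dominated convergence in `ℓ^q`):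
* block by block, `Δ̇_j e^{tΔ}U₀ = e^{tΔ}Δ̇_j U₀` (`lpBlock_heatSemigroup_comm`) and `Δ̇_j U₀` is an
  `L^p` function `g_j` (`‖Δ̇_j U₀‖_{L^p} ≤ 2^{-js}‖U₀‖_{Ḃ^s_{p,∞}} < ∞`); on `L^p` the flow is the
  Gauss–Weierstrass semigroup (`heatSemigroup_toTemperedDistribution_Lp_holds`), which is an
  `L^p` contraction (`eLpNorm_heatExtension_le_holds`) strongly continuous at `0⁺` for `p < ∞`
  (`tendsto_heatExtension_nhdsWithin_zero_holds`, Stein, *Singular Integrals*, III §2 Thm. 2);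
  the semigroup law gives `‖e^{tΔ}g - e^{t₀Δ}g‖_{L^p} ≤ ‖e^{|t-t₀|Δ}g - g‖_{L^p} → 0`
  (`tendsto_eLpNormDistrib_heatSemigroup_coe_sub`);
* the weights are dominated by `2C · 2^{js}‖Δ̇_j U₀‖_{L^p} ∈ ℓ^q` (uniform `L^p` bound of the
  heat flow on blocks, `exists_eLpNormDistrib_heatSemigroup_lpBlock_le`), and Lebesgue's theorem
  for the counting measure on `ℤ` (`tendsto_lintegral_filter_of_dominated_convergence`) concludes,
  `q < ∞`.

The statement is false for `q = ∞` in general; `p = ∞` is true but not covered by this proof.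

## References

* H. Bahouri, J.-Y. Chemin, R. Danchin, *Fourier Analysis and Nonlinear PDE* (2011), Lemma 2.4,
  Def. 2.15. [BahouriCheminDanchin2011]
* E. M. Stein, *Singular Integrals and Differentiability Properties of Functions* (1970),
  Ch. III §2, Thm. 2. [SteinSingularIntegrals1970]
-/

noncomputable section

open MeasureTheory Set Function Filter
open _root_.Topology
open scoped SchwartzMap ENNReal NNReal

namespace Literature.Analysis.FluidPDE

variable {E F : Type*} [NormedAddCommGroup E] [InnerProductSpace ℝ E] [FiniteDimensional ℝ E]
  [MeasurableSpace E] [BorelSpace E] [NormedAddCommGroup F] [NormedSpace ℂ F] [CompleteSpace F]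

/-! ## The heat flow of an `L^p` class, `p < ∞` -/

/-- The embedding `L^p → 𝓢'` commutes with subtraction. [folklore] -/
theorem coe_sub_Lp {p : ℝ≥0∞} [Fact (1 ≤ p)] (f g : Lp F p (volume : Measure E)) :
    ((f - g : Lp F p (volume : Measure E)) : 𝓢'(E, F)) = (f : 𝓢'(E, F)) - (g : 𝓢'(E, F)) := by
  rw [sub_eq_add_neg, coe_add_Lp, coe_neg_Lp, ← sub_eq_add_neg]

/-- **`e^{τΔ}` is an `L^p` contraction at the level of distributions**: for `h ∈ L^p`, `τ ≥ 0`,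
`‖e^{τΔ}↑h‖_{L^p} ≤ ‖h‖_{L^p}` (the Gauss–Weierstrass integral of an `L^p` function,
`heatSemigroup_toTemperedDistribution_Lp_holds`, `eLpNorm_heatExtension_le_holds`). [folklore] -/
theorem eLpNormDistrib_heatSemigroup_coe_le {p : ℝ≥0∞} [hp1 : Fact (1 ≤ p)]
    (h : Lp F p (volume : Measure E)) {τ : ℝ} (hτ : 0 ≤ τ) :
    FunctionSpaces.eLpNormDistrib p (TemperedDistribution.heatSemigroup τ (h : 𝓢'(E, F))) ≤ ‖h‖ₑ := by
  rcases hτ.eq_or_lt with h0 | hpos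
  · rw [← h0, TemperedDistribution.heatSemigroup_zero]
    show FunctionSpaces.eLpNormDistrib p (h : 𝓢'(E, F)) ≤ ‖h‖ₑ
    rw [FunctionSpaces.eLpNormDistrib_coe]
  · rw [MeasureTheory.Lp.heatSemigroup_toTemperedDistribution_Lp_holds
      UnboundedOperators.memLp_heatExtension_holds h hpos, FunctionSpaces.eLpNormDistrib_coe,
      Lp.enorm_toLp, Lp.enorm_def]
    exact UnboundedOperators.eLpNorm_heatExtension_le_holds (Lp.memLp h) hp1.out hpos

/-- **Strong continuity of the heat flow of an `L^p` class, `p < ∞`, on `[0, ∞)`**: for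
`g ∈ L^p(E; F)`, `1 ≤ p < ∞`, and `t₀ ≥ 0`, `‖e^{tΔ}↑g - e^{t₀Δ}↑g‖_{L^p} → 0` as `t → t₀` within
`[0, ∞)` (the semigroup law reduces it to `‖e^{|t-t₀|Δ}g - g‖_{L^p} → 0`, Stein III §2 Thm. 2,
`tendsto_heatExtension_nhdsWithin_zero_holds`, through the `L^p` contraction). [folklore] -/
theorem tendsto_eLpNormDistrib_heatSemigroup_coe_sub {p : ℝ≥0∞} [hp1 : Fact (1 ≤ p)] (hp : p < ∞)
    (g : Lp F p (volume : Measure E)) {t₀ : ℝ} (ht₀ : 0 ≤ t₀) :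
    Tendsto (fun t : ℝ => FunctionSpaces.eLpNormDistrib p
        (TemperedDistribution.heatSemigroup t (g : 𝓢'(E, F)) -
          TemperedDistribution.heatSemigroup t₀ (g : 𝓢'(E, F))))
      (𝓝[Ici 0] t₀) (𝓝 0) := by
  have hE : UnboundedOperators.heatSymbol_hasTemperateGrowth (E := E) :=
    UnboundedOperators.heatSymbol_hasTemperateGrowth_holds
  have hM : UnboundedOperators.memLp_heatExtension (E := E) (F := F) :=
    UnboundedOperators.memLp_heatExtension_holds
  -- the `L^p` flow `H τ = e^{τΔ}g` and the increments `Z τ = H τ - g`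
  set H : ∀ τ : ℝ, 0 < τ → Lp F p (volume : Measure E) := fun τ hτ =>
    (MeasureTheory.Lp.memLp_heatExtension hM g hτ).toLp _ with hHdef
  have hH : ∀ (τ : ℝ) (hτ : 0 < τ), TemperedDistribution.heatSemigroup τ (g : 𝓢'(E, F)) =
      ((H τ hτ : Lp F p (volume : Measure E)) : 𝓢'(E, F)) := fun τ hτ =>
    MeasureTheory.Lp.heatSemigroup_toTemperedDistribution_Lp_holds hM g hτ
  have hZ : ∀ (τ : ℝ) (hτ : 0 < τ), ‖H τ hτ - g‖ₑ =
      eLpNorm (UnboundedOperators.heatExtension (g : E → F) τ - (g : E → F)) p volume := by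
    intro τ hτ
    rw [Lp.enorm_def]
    refine eLpNorm_congr_ae ?_
    filter_upwards [Lp.coeFn_sub (H τ hτ) g,
      (MeasureTheory.Lp.memLp_heatExtension hM g hτ).coeFn_toLp] with x hx h1
    rw [hx, Pi.sub_apply, h1, Pi.sub_apply]
  -- the key estimate: the increment of the flow is controlled by `‖e^{|t-t₀|Δ}g - g‖`
  have hkey : ∀ {a b : ℝ} (ha : 0 ≤ a) (hab : a < b),
      FunctionSpaces.eLpNormDistrib p (TemperedDistribution.heatSemigroup b (g : 𝓢'(E, F)) -
        TemperedDistribution.heatSemigroup a (g : 𝓢'(E, F))) ≤ ‖H (b - a) (sub_pos.2 hab) - g‖ₑ := by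
    intro a b ha hab
    have hba : 0 < b - a := sub_pos.2 hab
    have hcomp : (TemperedDistribution.heatSemigroup b : 𝓢'(E, F) →L[ℂ] 𝓢'(E, F)) =
        TemperedDistribution.heatSemigroup a * TemperedDistribution.heatSemigroup (b - a) := by
      rw [← TemperedDistribution.heatSemigroup_add hE ha hba.le]
      congr 1
      ring
    have hsplit : TemperedDistribution.heatSemigroup b (g : 𝓢'(E, F)) =
        TemperedDistribution.heatSemigroup a
          (TemperedDistribution.heatSemigroup (b - a) (g : 𝓢'(E, F))) := by
      rw [hcomp]
      rfl
    rw [hsplit, ← map_sub, hH (b - a) hba, ← coe_sub_Lp]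
    exact eLpNormDistrib_heatSemigroup_coe_le _ ha
  have hkey' : ∀ {a b : ℝ} (ha : 0 ≤ a) (hab : a < b),
      FunctionSpaces.eLpNormDistrib p (TemperedDistribution.heatSemigroup a (g : 𝓢'(E, F)) -
        TemperedDistribution.heatSemigroup b (g : 𝓢'(E, F))) ≤ ‖H (b - a) (sub_pos.2 hab) - g‖ₑ := by
    intro a b ha hab
    rw [← eLpNormDistrib_neg, neg_sub]
    exact hkey ha hab
  -- strong continuity at `0⁺` in `L^p`
  have hω : Tendsto (fun τ : ℝ => eLpNorm (UnboundedOperators.heatExtension (g : E → F) τ - (g : E → F))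
      p volume) (𝓝[>] 0) (𝓝 0) :=
    UnboundedOperators.tendsto_heatExtension_nhdsWithin_zero_holds (Lp.memLp g) hp1.out hp.ne
  -- conclusion, `ε`–`δ`
  rw [ENNReal.tendsto_nhds_zero]
  intro ε hε
  have hev : ∀ᶠ τ in 𝓝[>] (0 : ℝ), eLpNorm (UnboundedOperators.heatExtension (g : E → F) τ -
      (g : E → F)) p volume ≤ ε := by
    have h := (ENNReal.tendsto_nhds_zero.1 hω) ε hε
    exact h
  rw [Filter.Eventually, mem_nhdsGT_iff_exists_Ioo_subset] at hev
  obtain ⟨δ, hδ, hδε⟩ := hev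
  have hδ0 : 0 < δ := hδ
  have hmem : Ioo (t₀ - δ) (t₀ + δ) ∈ 𝓝 t₀ := Ioo_mem_nhds (by linarith) (by linarith)
  filter_upwards [mem_nhdsWithin_of_mem_nhds hmem, self_mem_nhdsWithin] with t ht ht0
  have ht0' : 0 ≤ t := ht0
  rcases lt_trichotomy t t₀ with hlt | heq | hgt
  · have hτ : t₀ - t ∈ Ioo 0 δ := ⟨sub_pos.2 hlt, by linarith [ht.1]⟩
    calc _ ≤ ‖H (t₀ - t) (sub_pos.2 hlt) - g‖ₑ := hkey' ht0' hlt
      _ = _ := hZ (t₀ - t) (sub_pos.2 hlt)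
      _ ≤ ε := hδε hτ
  · rw [heq, sub_self, FunctionSpaces.eLpNormDistrib_zero]
    exact zero_le
  · have hτ : t - t₀ ∈ Ioo 0 δ := ⟨sub_pos.2 hgt, by linarith [ht.2]⟩
    calc _ ≤ ‖H (t - t₀) (sub_pos.2 hgt) - g‖ₑ := hkey ht₀ hgt
      _ = _ := hZ (t - t₀) (sub_pos.2 hgt)
      _ ≤ ε := hδε hτ

/-! ## Strong continuity on `Ḃ^s_{p,q}` -/

/-- **The heat semigroup is strongly continuous on `Ḃ^s_{p,q}` for `p, q < ∞`**
(Bahouri–Chemin–Danchin 2011, Lemma 2.4 — `‖e^{tΔ}Δ̇_j u‖_{L^p} ≤ Ce^{-ct2^{2j}}‖Δ̇_j u‖_{L^p}` —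
blockwise, and dominated convergence in `ℓ^q(ℤ)`; GKP 2016, §1.2: `e^{tΔ}u₀ ∈ C([0,T]; Ḃ^{s_p}_{p,q})`):
for `s ∈ ℝ`, `1 ≤ p < ∞`, `1 ≤ q < ∞`, `U₀ ∈ Ḃ^s_{p,q}` and `t₀ ≥ 0`,
`‖e^{tΔ}U₀ - e^{t₀Δ}U₀‖_{Ḃ^s_{p,q}} → 0` as `t → t₀`, `t ≥ 0`. Each block is the `L^p` heat flow of
the `L^p` function `Δ̇_j U₀`, continuous by `tendsto_eLpNormDistrib_heatSemigroup_coe_sub`; the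
weights are dominated by `2C 2^{js}‖Δ̇_j U₀‖_{L^p} ∈ ℓ^q`. This is the statement (with `p < ∞`)
of item (F6) of the decomposition of `exists_isBesovMildSolutionOn`. [cite: BahouriCheminDanchin2011, Lemma 2.4] -/
theorem tendsto_eHomBesovNorm_heatSemigroup_sub {s : ℝ} {p q : ℝ≥0∞} [hp1 : Fact (1 ≤ p)]
    (hp : p < ∞) (hq₁ : 1 ≤ q) (hq : q < ∞) {U₀ : 𝓢'(E, F)}
    (hU₀ : FunctionSpaces.MemHomBesov s p q U₀) {t₀ : ℝ} (ht₀ : 0 ≤ t₀) :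
    Tendsto (fun t : ℝ => FunctionSpaces.eHomBesovNorm s p q
        (TemperedDistribution.heatSemigroup t U₀ - TemperedDistribution.heatSemigroup t₀ U₀))
      (𝓝[Ici 0] t₀) (𝓝 0) := by
  have hq0 : q ≠ 0 := (zero_lt_one.trans_le hq₁).ne'
  have hqtop : q ≠ ∞ := hq.ne
  have hqr : 0 < q.toReal := ENNReal.toReal_pos hq0 hqtop
  -- ### the blocks of `U₀` are `L^p` functions
  have hblock_fin : ∀ j : ℤ, FunctionSpaces.eLpNormDistrib p (FunctionSpaces.lpBlock j U₀) < ∞ := by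
    intro j
    have h := FunctionSpaces.eLpNormDistrib_lpBlock_le_two_rpow_mul_eHomBesovNorm_neg
      (p := p) (-s) U₀ j
    rw [neg_neg] at h
    have h2 : (2 : ℝ≥0∞) ^ ((j : ℝ) * -s) ≠ ⊤ := by simp [ENNReal.rpow_eq_top_iff]
    exact h.trans_lt (ENNReal.mul_lt_top h2.lt_top
      ((eHomBesovNorm_exponent_antitone s p hq0 le_top U₀).trans_lt hU₀.1))
  have hrep : ∀ j : ℤ, ∃ g : Lp F p (volume : Measure E),
      (g : 𝓢'(E, F)) = FunctionSpaces.lpBlock j U₀ := fun j =>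
    FunctionSpaces.exists_coe_eq_of_eLpNormDistrib_lt_top (hblock_fin j)
  choose g hg using hrep
  -- ### blockwise continuity
  have hblock : ∀ j : ℤ, Tendsto (fun t => FunctionSpaces.lpBlockWeight s p
      (TemperedDistribution.heatSemigroup t U₀ - TemperedDistribution.heatSemigroup t₀ U₀) j)
      (𝓝[Ici 0] t₀) (𝓝 0) := by
    intro j
    have h := tendsto_eLpNormDistrib_heatSemigroup_coe_sub hp (g j) ht₀
    have h2s : (2 : ℝ≥0∞) ^ ((j : ℝ) * s) ≠ ⊤ := by simp [ENNReal.rpow_eq_top_iff]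
    have h2 := ENNReal.Tendsto.const_mul h (a := (2 : ℝ≥0∞) ^ ((j : ℝ) * s)) (Or.inr h2s)
    rw [mul_zero] at h2
    refine h2.congr' ?_
    filter_upwards [self_mem_nhdsWithin] with t ht
    have ht' : (0 : ℝ) ≤ t := ht
    simp only [FunctionSpaces.lpBlockWeight]
    rw [map_sub, FunctionSpaces.lpBlock_heatSemigroup_comm ht', FunctionSpaces.lpBlock_heatSemigroup_comm ht₀,
      ← hg j]
  -- ### domination by `2C · 2^{js}‖Δ̇_j U₀‖_{L^p}`
  obtain ⟨C, -, hC⟩ := FunctionSpaces.exists_eLpNormDistrib_heatSemigroup_lpBlock_le (E := E) (F := F) p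
  have hflow : ∀ (τ : ℝ), 0 ≤ τ → ∀ j : ℤ,
      FunctionSpaces.eLpNormDistrib p (TemperedDistribution.heatSemigroup τ (FunctionSpaces.lpBlock j U₀)) ≤
        C * FunctionSpaces.eLpNormDistrib p (FunctionSpaces.lpBlock j U₀) := by
    intro τ hτ j
    have hexp : ENNReal.ofReal (Real.exp (-(Real.pi ^ 2 / 8) * 2 ^ (2 * j) * τ)) ≤ 1 := by
      refine ENNReal.ofReal_le_one.2 (Real.exp_le_one_iff.2 ?_)
      have : (0 : ℝ) ≤ Real.pi ^ 2 / 8 * 2 ^ (2 * j) * τ := by positivity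
      linarith
    calc FunctionSpaces.eLpNormDistrib p (TemperedDistribution.heatSemigroup τ (FunctionSpaces.lpBlock j U₀))
        ≤ C * ENNReal.ofReal (Real.exp (-(Real.pi ^ 2 / 8) * 2 ^ (2 * j) * τ)) *
            FunctionSpaces.eLpNormDistrib p (FunctionSpaces.lpBlock j U₀) := hC τ hτ j U₀
      _ ≤ C * 1 * FunctionSpaces.eLpNormDistrib p (FunctionSpaces.lpBlock j U₀) := by gcongr
      _ = C * FunctionSpaces.eLpNormDistrib p (FunctionSpaces.lpBlock j U₀) := by rw [mul_one]
  have hdom : ∀ (t : ℝ), 0 ≤ t → ∀ j : ℤ, FunctionSpaces.lpBlockWeight s p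
      (TemperedDistribution.heatSemigroup t U₀ - TemperedDistribution.heatSemigroup t₀ U₀) j ≤
        ((C : ℝ≥0∞) + C) * FunctionSpaces.lpBlockWeight s p U₀ j := by
    intro t ht j
    simp only [FunctionSpaces.lpBlockWeight]
    rw [map_sub, FunctionSpaces.lpBlock_heatSemigroup_comm ht, FunctionSpaces.lpBlock_heatSemigroup_comm ht₀]
    calc (2 : ℝ≥0∞) ^ ((j : ℝ) * s) * FunctionSpaces.eLpNormDistrib p
          (TemperedDistribution.heatSemigroup t (FunctionSpaces.lpBlock j U₀) -
            TemperedDistribution.heatSemigroup t₀ (FunctionSpaces.lpBlock j U₀))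
        ≤ (2 : ℝ≥0∞) ^ ((j : ℝ) * s) *
            (FunctionSpaces.eLpNormDistrib p (TemperedDistribution.heatSemigroup t (FunctionSpaces.lpBlock j U₀)) +
              FunctionSpaces.eLpNormDistrib p (TemperedDistribution.heatSemigroup t₀ (FunctionSpaces.lpBlock j U₀))) := by
          gcongr
          rw [sub_eq_add_neg]
          exact (eLpNormDistrib_add_le _ _).trans_eq (by rw [eLpNormDistrib_neg])
      _ ≤ (2 : ℝ≥0∞) ^ ((j : ℝ) * s) *
            (C * FunctionSpaces.eLpNormDistrib p (FunctionSpaces.lpBlock j U₀) +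
              C * FunctionSpaces.eLpNormDistrib p (FunctionSpaces.lpBlock j U₀)) := by
          gcongr
          · exact hflow t ht j
          · exact hflow t₀ ht₀ j
      _ = ((C : ℝ≥0∞) + C) * ((2 : ℝ≥0∞) ^ ((j : ℝ) * s) *
            FunctionSpaces.eLpNormDistrib p (FunctionSpaces.lpBlock j U₀)) := by ring
  -- ### dominated convergence in `ℓ^q(ℤ)`
  set bound : ℤ → ℝ≥0∞ := fun j => (((C : ℝ≥0∞) + C) * FunctionSpaces.lpBlockWeight s p U₀ j) ^ q.toReal
    with hbound
  have hlint_eq : ∀ (w : ℤ → ℝ≥0∞), eLpNorm w q Measure.count =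
      (∫⁻ j, w j ^ q.toReal ∂Measure.count) ^ (1 / q.toReal) := by
    intro w
    rw [eLpNorm_eq_lintegral_rpow_enorm_toReal hq0 hqtop]
    simp only [enorm_eq_self]
  have hbound_fin : ∫⁻ j, bound j ∂Measure.count ≠ ∞ := by
    have hCC : ((C : ℝ≥0∞) + C) ^ q.toReal ≠ ⊤ :=
      ENNReal.rpow_ne_top_of_nonneg hqr.le (ENNReal.add_ne_top.2 ⟨ENNReal.coe_ne_top, ENNReal.coe_ne_top⟩)
    have h1 : ∫⁻ j, bound j ∂Measure.count =
        ((C : ℝ≥0∞) + C) ^ q.toReal * ∫⁻ j, FunctionSpaces.lpBlockWeight s p U₀ j ^ q.toReal ∂Measure.count := by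
      rw [← lintegral_const_mul' _ _ hCC]
      refine lintegral_congr fun j => ?_
      show (((C : ℝ≥0∞) + C) * FunctionSpaces.lpBlockWeight s p U₀ j) ^ q.toReal = _
      rw [ENNReal.mul_rpow_of_nonneg _ _ hqr.le]
    have h2 : (∫⁻ j, FunctionSpaces.lpBlockWeight s p U₀ j ^ q.toReal ∂Measure.count) =
        FunctionSpaces.eHomBesovNorm s p q U₀ ^ q.toReal := by
      rw [FunctionSpaces.eHomBesovNorm, hlint_eq, ← ENNReal.rpow_mul, one_div,
        inv_mul_cancel₀ hqr.ne', ENNReal.rpow_one]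
    rw [h1, h2]
    exact ENNReal.mul_ne_top hCC (ENNReal.rpow_ne_top_of_nonneg hqr.le hU₀.1.ne)
  have hlin : Tendsto (fun t => ∫⁻ j, FunctionSpaces.lpBlockWeight s p
      (TemperedDistribution.heatSemigroup t U₀ - TemperedDistribution.heatSemigroup t₀ U₀) j ^ q.toReal
        ∂Measure.count) (𝓝[Ici 0] t₀) (𝓝 (∫⁻ _ : ℤ, (0 : ℝ≥0∞) ∂Measure.count)) := by
    refine tendsto_lintegral_filter_of_dominated_convergence bound ?_ ?_ hbound_fin ?_
    · exact Eventually.of_forall fun t => Measurable.of_discrete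
    · filter_upwards [self_mem_nhdsWithin] with t ht
      exact Eventually.of_forall fun j => ENNReal.rpow_le_rpow (hdom t ht j) hqr.le
    · refine Eventually.of_forall fun j => ?_
      have h := ((ENNReal.continuous_rpow_const (y := q.toReal)).tendsto 0).comp (hblock j)
      simpa only [Function.comp_def, ENNReal.zero_rpow_of_pos hqr] using h
  rw [lintegral_zero] at hlin
  -- ### the `q`-th root
  have hroot := ((ENNReal.continuous_rpow_const (y := 1 / q.toReal)).tendsto 0).comp hlin
  rw [ENNReal.zero_rpow_of_pos (by positivity)] at hroot
  refine hroot.congr' (Eventually.of_forall fun t => ?_)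
  simp only [Function.comp_apply, FunctionSpaces.eHomBesovNorm]
  exact (hlint_eq _).symm

end Literature.Analysis.FluidPDE
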